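import Mathlib
import Summits.NavierStokesRegularity.NavierStokesRegularity.Theorems.TaoLadderRungTwoFlatSectionTime
import Summits.NavierStokesRegularity.NavierStokesRegularity.Theorems.TaoLadderRungTwoFlatEntryHandoverLanding
import HarnessLib

/-!
# The CORE LANDING in frame form: `CoreClause (n+1)` of the state re-centred at the section time `τ₁ = τ − h`
  (helper for the K_A♭ parent item stmt-NavierStokesRegularity-22987 `FlatGapCertificatesV2`, children 1A/2A of route
  TaoLadderRungTwoFlat; cell harvest/h2-tao-ladder, p1 g22; LADDER §50.8/§51, `HopTube.TubeStepCore` for the flat tube)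

Composition of three tree pieces: `MirrorPulse.landing_at_section_time` (phase → section time, second order),
theory-1's section-state dictionary (`HopTube.sectionState`, `refScale_mul_sectionState`, `anchorScale_mismatch_le`)
and the landing wrapper `HopTube.core_landing_of_gauge_capture` (⇒ `coreClause_recentre`). The reference at hop `n+1`
is the pulse's profile at the certificate time read one shell up, `Φ₀ k := Φ(1+k, τ)` (for a shift-periodic pulse this
is the phase-`0` profile), normalised to the section state `u⋆ = sectionState A_* i₀ Φ₀`; the landing state's own
anchor coordinate selects the member `x′·u⋆`, and the mismatch `|x′ − κ|Φ₀ i₀ 0|/A_*|` is controlled by the landing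
error at the anchor site (`anchorScale_mismatch_le` with `δ₁ = 0`).

* `HopTube.core_landing_at_section_time` — **for global solutions `X` (hop flow) and `Φ` (pulse) of `T♭(ε)` with head-gauge
  bounds near `τ`, a head-gauge landing datum `g^{m⁺}|X_m(τ) − κΦ_m(τ+h)| ≤ D` on `m ≥ −K` (what `anchored_landing` and the
  edge-shell bound provide), `κ ≥ 0`, `|h| ≤ 1`, the gauge profile constant `M_ω ≥ ω|u⋆|` on `k ≥ −K`, and the budget
  `η₁ + (η₁/ω₀/A_*)·M_ω ≤ a·δ(n+1)` with `η₁ = D + O(h² + |h||κ−1| + |h|D + |h|D²)` the explicit bound of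
  `landing_at_section_time` and `ω₀ = geomGauge g b i₀ 0`: `CoreClause P i₀ u⋆ (n+1) (recentre X (τ − h) a)`.**

HONEST FRAMING: bookkeeping about MODEL-lattice solutions (Tao 2016 §4 vocabulary on `S♭`); all bounds are HYPOTHESES;
nothing certified; no item closed; nothing about the Navier–Stokes equations.
-/

noncomputable section

-- the sub-problem namespace repeats the summit name by design (D-0017)
set_option linter.dupNamespace false

namespace Summit.NavierStokesRegularity.NavierStokesRegularity.Theorems.HopTube

open Set Finset Literature.Analysis.FluidPDE Literature.Analysis.FluidPDE.TaoCascade QuadPolar MirrorPulse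

/-- **CORE LANDING AT THE SECTION TIME.** See the module docstring.
[cite: Tao2016AveragedNS, §6.3–6.4 (statement shape of the checkpoint step: re-centring and modulation); route TaoLadderRungTwoFlat, L5a landing ⇒ `HopTube.TubeStepCore` for the flat tube (LADDER §50.8, §51)] -/
theorem core_landing_at_section_time (P : TubeSchedule) {ε : ℝ} {Φ X : Fin 2 → ℤ → ℝ → ℝ} {i₀ : Fin 2}
    {M Mw MX D κ h τ a Mω : ℝ} {n : ℕ}
    (hΦ : IsGlobalSol ε Φ) (hX : IsGlobalSol ε X) (hg : 1 ≤ P.g) (hb : 1 ≤ P.b) (hA : 0 < P.Astar)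
    (hΦb : ∀ i m t, |Φ i m t| ≤ M)
    (hMw : 0 ≤ Mw) (hΦg : ∀ j k, ∀ t ∈ Icc (τ - 1) (τ + 1), headGauge P.g j k * |Φ j k t| ≤ Mw)
    (hMX : 0 ≤ MX) (hXg : ∀ j k, ∀ t ∈ Icc (τ - 1) (τ + 1), headGauge P.g j k * |X j k t| ≤ MX)
    (hh : |h| ≤ 1) (hκ : 0 ≤ κ) (hD0 : 0 ≤ D) (hΦa : Φ i₀ 1 τ ≠ 0)
    (hD : ∀ (j : Fin 2) (m : ℤ), -(P.K : ℤ) - 1 ≤ m → headGauge P.g j m * |X j m τ - κ * Φ j m (τ + h)| ≤ D)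
    (hMω : ∀ (i : Fin 2) (k : ℤ), -(P.K : ℤ) ≤ k →
      geomGauge P.g P.b i k * |sectionState P.Astar i₀ (fun i k => Φ i (1 + k) τ) i k| ≤ Mω)
    (ha : 0 < a)
    (hbudget :
      (D + 2 * (tableAbsSum shiftSetFlat (mirrorTable ε ε)) ^ 2 * P.g ^ 2 * (MX ^ 3 + 2 * |κ| * Mw ^ 3) * h ^ 2
        + |h| * (|κ| * |1 - κ| * (tableAbsSum shiftSetFlat (mirrorTable ε ε) * P.g * Mw ^ 2)
          + 2 * tableAbsSum shiftSetFlat (mirrorTable ε ε) * (|κ| * M) * P.g * D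
          + tableAbsSum shiftSetFlat (mirrorTable ε ε) * P.g * D ^ 2))
      + ((D + 2 * (tableAbsSum shiftSetFlat (mirrorTable ε ε)) ^ 2 * P.g ^ 2 * (MX ^ 3 + 2 * |κ| * Mw ^ 3) * h ^ 2
          + |h| * (|κ| * |1 - κ| * (tableAbsSum shiftSetFlat (mirrorTable ε ε) * P.g * Mw ^ 2)
            + 2 * tableAbsSum shiftSetFlat (mirrorTable ε ε) * (|κ| * M) * P.g * D
            + tableAbsSum shiftSetFlat (mirrorTable ε ε) * P.g * D ^ 2))
          / geomGauge P.g P.b i₀ 0 / P.Astar) * Mω ≤ a * P.δ (n + 1)) :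
    CoreClause P i₀ (sectionState P.Astar i₀ (fun i k => Φ i (1 + k) τ)) (n + 1) (recentre X (τ - h) a) := by
  -- abbreviation for the landing error (opaque with its defining equation)
  obtain ⟨η₁, hη₁⟩ : ∃ η₁ : ℝ, η₁ =
      D + 2 * (tableAbsSum shiftSetFlat (mirrorTable ε ε)) ^ 2 * P.g ^ 2 * (MX ^ 3 + 2 * |κ| * Mw ^ 3) * h ^ 2
        + |h| * (|κ| * |1 - κ| * (tableAbsSum shiftSetFlat (mirrorTable ε ε) * P.g * Mw ^ 2)
          + 2 * tableAbsSum shiftSetFlat (mirrorTable ε ε) * (|κ| * M) * P.g * D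
          + tableAbsSum shiftSetFlat (mirrorTable ε ε) * P.g * D ^ 2) := ⟨_, rfl⟩
  rw [← hη₁] at hbudget
  have hg0 : 0 ≤ P.g := by linarith
  have hω₀ : 0 < geomGauge P.g P.b i₀ 0 := geomGauge_pos (by linarith) (by linarith) i₀ 0
  -- (1) landing closeness to `κΦ₀` in the contraction gauge on `k ≥ −K`
  have hland : ∀ (i : Fin 2) (k : ℤ), -(P.K : ℤ) ≤ k →
      geomGauge P.g P.b i k * |X i (1 + k) (τ - h) - κ * Φ i (1 + k) τ| ≤ η₁ := by
    intro i k hk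
    have h1 := landing_at_section_time (e := -(P.K : ℤ) - 1) hΦ hX hg hΦb hMw hΦg hMX hXg hh hD0 hD i (1 + k)
      (by omega)
    rw [← hη₁] at h1
    have hωle : geomGauge P.g P.b i k ≤ headGauge P.g i (1 + k) := by
      rw [add_comm]
      exact (geomGauge_le_succ hg hb i k).trans (geomGauge_le_headGauge hg0 hb i (k + 1))
    exact (mul_le_mul_of_nonneg_right hωle (abs_nonneg _)).trans h1
  -- (2) the reference IS a member of the section-state family: `κΦ₀ = x_r·u⋆`
  have hΦa' : (fun i k => Φ i (1 + k) τ) i₀ 0 ≠ 0 := by simpa using hΦa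
  have href : ∀ (i : Fin 2) (k : ℤ), -(P.K : ℤ) ≤ k →
      geomGauge P.g P.b i k * |κ * Φ i (1 + k) τ
        - κ * |(fun i k => Φ i (1 + k) τ) i₀ 0| / P.Astar
          * sectionState P.Astar i₀ (fun i k => Φ i (1 + k) τ) i k| ≤ 0 := by
    intro i k _
    rw [refScale_mul_sectionState (Φ₀ := fun i k => Φ i (1 + k) τ) (i₀ := i₀) (κ := κ) hA.ne' hΦa' i k]
    simp
  -- (3) the anchor-scale mismatch from the landing error at the anchor site
  have hanchor : |X i₀ (1 + 0) (τ - h) - κ * Φ i₀ (1 + 0) τ| ≤ η₁ / geomGauge P.g P.b i₀ 0 := by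
    rw [le_div_iff₀ hω₀, mul_comm]
    exact hland i₀ 0 (by omega)
  have hx : abs (|X i₀ 1 (τ - h)| / P.Astar - κ * |(fun i k => Φ i (1 + k) τ) i₀ 0| / P.Astar)
      ≤ (η₁ / geomGauge P.g P.b i₀ 0 + 0 / geomGauge P.g P.b i₀ 0) / P.Astar := by
    have h1 := anchorScale_mismatch_le (δ₁ := 0) (ref₀ := κ * Φ i₀ (1 + 0) τ)
      (Φ₀₀ := (fun i k => Φ i (1 + k) τ) i₀ 0) hA hκ hω₀ hanchor (by simp)
    simpa only [add_zero] using h1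
  -- (4) the landing wrapper
  refine core_landing_of_gauge_capture P ha hg hb (ref := fun i k => κ * Φ i (1 + k) τ) hland href hMω hx ?_
  have e0 : (η₁ / geomGauge P.g P.b i₀ 0 + 0 / geomGauge P.g P.b i₀ 0) / P.Astar
      = η₁ / geomGauge P.g P.b i₀ 0 / P.Astar := by rw [zero_div, add_zero]
  rw [e0, add_zero]
  exact hbudget

end Summit.NavierStokesRegularity.NavierStokesRegularity.Theorems.HopTube

end
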